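import Literature.AnabelianGeometry.EtaleTheta.Discharge.Sec2ConjPowersCoboundary
import Literature.AnabelianGeometry.EtaleTheta.Discharge.Sec2GeometricConjClasses
import Literature.AnabelianGeometry.EtaleTheta.Discharge.Sec2Cor216OfModelLemmas
import Literature.AnabelianGeometry.EtaleTheta.Discharge.Sec2NondiscretenessGenProofs

/-!
# [EtTh] Cor 2.16 for the §1 MODEL, modulo Prop 1.5 (ii), (iii) only (the bi-theta shift clause
# `hshift` of `cor216_of_model` DISCHARGED)

Mochizuki, *The Étale Theta Function and its Frobenioid-theoretic Manifestations* [EtTh],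
Publ. RIMS 45 (2009), §2, Cor 2.16 pp.53–54 and Prop 2.14 (iii) p.50, over §1 Prop 1.5 (p.23)
(locators `p.N` = PDF pages of the PRIMS text; bib key `MochizukiEtTh2009`). PROOF-ONLY companion
(no `def`; seat abc-iut-L2-t2, DAG node `EtTh:Cor2.16`) of `ThetaSystems.lean` (`ThetaEnvTower.Cor216`)
and of abc-iut-L2-t8's model tower `DoubleUnderline.thetaEnvTower` (`TowerOfSetting.lean`).

`Discharge/Sec2TowerOfSettingCorollaries.lean` / `…NondiscretenessGenProofs.lean` (this seat) left Cor 2.16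
for the model conditional on ONE binder `hshift` — the bi-theta symmetry clause of Prop 2.14 (iii) in
cocycle form: conjugation by `x^a`, `M ∣ a`, of a generator `x` of `Gal(Y̲̲/X̲̲)` moves every mod-`M`
theta cocycle by a coboundary. Here `hshift` is PROVED for the §1 model from abc-iut-L2-t1's named facts
`Prop15iii` (the `Z`-action formula for `η̈^Θ`) and `Prop15ii` (`log(Ü) ∈ F̈¹`, `F̈² = ` Kummer classes) —
exactly the printed dependency of Prop 2.14 / Cor 2.16 on Prop 1.5 — WITHOUT sharpening the printed
"`+ log(O^×_K̈)`" of Prop 1.5 (iii): for a GEOMETRIC generator `x` (`aug x = 1`,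
`exists_geometric_generator`) and a root cocycle `f` of `η̲̈^{Θ,l·ℤ×μ₂}`,

* the conjugates `x^i·f` are controlled through the SECOND DIFFERENCE of the orbit, whose class is
  `V^{2a}` with `V ∈ F̈²` fixed by `x̄` (`secondDiff_conj_etaDd_eq`; Prop 1.5 (iii) applied once, the
  quadratic and unit terms cancel) — so no relation between the units `u_σ` of Prop 1.5 (iii) at
  different `σ` is needed;
* the `l·Δ_Θ`-valued second difference is `ρ^{2l·e} · ∂b` with `b ∈ Δ_Θ` (not necessarily in `l·Δ_Θ` — the
  "`l`-th root" ambiguity of p.41–42); modulo `M` the stray `∂b` reduces to a SQUARE times a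
  `μ_M`-coboundary because `l` is odd (`CyclotomeMod.red_cob_eq_sq_mul`), which is all the generic algebra
  `ThetaEnvTower.conjCocycle_zpow_eq_mul_coboundary_of_secondDiff` needs.

Main results: `DoubleUnderline.conjCocycle_zpow_modN_eq_mul_coboundary` (the bi-theta shift clause for
`M·(l·ℤ)`-conjugates by a geometric element, Prop 2.14 (iii) p.50, for the model) and
`DoubleUnderline.cor216_of_model_of_prop15` : `(C.thetaEnvTower τ hC hS).Cor216` from `Prop15iii`,
`Prop15ii` alone. HONEST FRAMING: [EtTh] is refereed; these are OUR kernel checks of the printed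
reductions conditional on the named §1 facts; no side is taken on [IUTchIII] Cor 3.12.
-/

noncomputable section

namespace Literature.AnabelianGeometry.EtaleTheta

open Literature.AnabelianGeometry.SemiGraphs
open scoped IsMulCommutative

namespace ThetaSetting

variable {p : ℕ} [Fact p.Prime] {D : ThetaSetting p}

namespace CyclotomeMod

/-- `red` depends only on the underlying element (bookkeeping for dependent subtypes).
[cite: MochizukiEtTh2009, Def 2.13 p.46] -/
theorem red_eq_of_val_eq {l : ℕ} {N : ℕ+} (μ : D.CyclotomeMod l N) {v v' : D.GtpTheta}
    (hv : v ∈ D.lDeltaTheta l) (hv' : v' ∈ D.lDeltaTheta l) (h : v = v') :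
    μ.red ⟨v, hv⟩ = μ.red ⟨v', hv'⟩ := by
  subst h; rfl

end CyclotomeMod

namespace EtaleThetaData.DoubleUnderline

variable {E : D.EtaleThetaData} {l : ℕ} (C : E.DoubleUnderline l) {Es : Set ℕ+}
  (τ : D.CyclotomeTower l Es)

/-- Conjugating ANY `μ_M`-valued function on `Π^tp_Ÿ̲̲` by a geometric `x ∈ Π^tp_X̲̲` is precomposition with
`k ↦ x⁻¹ k x` (the character factor is trivial). [cite: MochizukiEtTh2009, Cor 2.16 p.54] -/
theorem conjCocycle_apply_of_aug_eq_one (hC : D.Compat) (hS : D.Sec2Hyps) (M : Es)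
    (φ : D.GtpYdd.subgroupOf C.Huu → MuN p M) (x : C.Huu) (hx : D.aug.toMonoidHom (x : D.PiTemp) = 1)
    (g : D.GtpYdd.subgroupOf C.Huu) :
    (C.thetaEnvTower τ hC hS).conjCocycle M x φ g = φ ⟨x⁻¹ * g * x, by
      simpa [mul_assoc] using (C.thetaEnvTower τ hC hS).PiYdd_normal.conj_mem _ g.2 x⁻¹⟩ := by
  have hχ : (C.thetaEnvTower τ hC hS).chi M ((C.thetaEnvTower τ hC hS).aug x) = 1 := by
    change galMuN p M (D.aug.toMonoidHom ((x : C.Huu) : D.PiTemp)) = 1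
    rw [hx, map_one]
  change (C.thetaEnvTower τ hC hS).chi M ((C.thetaEnvTower τ hC hS).aug x) (φ _) = _
  rw [hχ, MulAut.one_apply]

/-- **The second difference of a root cocycle along a geometric element, pointwise** (§1 input of the
bi-theta clause): for a root cocycle `f` of `η̲̈^{Θ,l·ℤ×μ₂}` on `Π^tp_Ÿ̲̲` and a GEOMETRIC `x ∈ Π^tp_X̲̲`, writing
`(x·f)(k) = f(x⁻¹ k x)`, there are `ρ₀ : Π^tp_Ÿ̲̲ → Δ_Θ` and `b, B ∈ Δ_Θ` with
`(x²·f)·f·(x·f)⁻² = ρ₀^{2l}·∂b` and `x·ρ₀ = ρ₀·∂B` — from `secondDiff_conj_etaDd_eq` (Prop 1.5 (ii), (iii)):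
`ρ₀` is (the `zExp x`-th power of) an inflated representative of the class `V ∈ F̈²`, which `x̄` fixes.
The element `b` need NOT lie in `l·Δ_Θ` (the `l`-th-root ambiguity, pp.41–42).
[cite: MochizukiEtTh2009, Prop 2.14(iii) p.50] -/
theorem exists_secondDiff_pointwise (hC : D.Compat) (h15 : Prop15iii E hC)
    (h15ii : Prop15ii E.toKummerData hC) {f : contCocycles D.toTheta D.DeltaTheta C.GtpYdduu}
    (hf : f ∈ C.rootCocycles hC) (x : C.Huu) (hx : D.aug.toMonoidHom (x : D.PiTemp) = 1) :
    ∃ (ρ₀ : C.GtpYdduu → D.DeltaTheta) (b B : D.DeltaTheta),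
      (∀ k : C.GtpYdduu,
        f.1 ⟨_, C.inv_mul_mul_mem_GtpYdduu hC x ⟨_, C.inv_mul_mul_mem_GtpYdduu hC x k⟩⟩ * f.1 k *
            (f.1 ⟨_, C.inv_mul_mul_mem_GtpYdduu hC x k⟩ ^ 2)⁻¹ =
          ρ₀ k ^ (2 * l) * (MulAut.conjNormal (D.toTheta (k : D.PiTemp)) b * b⁻¹)) ∧
      (∀ k : C.GtpYdduu, ρ₀ ⟨_, C.inv_mul_mul_mem_GtpYdduu hC x k⟩ =
          ρ₀ k * (MulAut.conjNormal (D.toTheta (k : D.PiTemp)) B * B⁻¹)) := by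
  haveI := hC.GtpYdd_normal
  haveI := hC.GtpYddTheta_normal
  -- ### §1 data: representatives
  obtain ⟨f₀, hf₀⟩ : ∃ f₀ : contCocycles D.toTheta D.DeltaTheta D.GtpYdd,
      (QuotientGroup.mk f₀ : D.H1 D.GtpYdd) = E.etaDd := QuotientGroup.mk_surjective _
  obtain ⟨σ, -, hclass⟩ := hf.2
  set g₀ := ContH1.conjCocycle D.toTheta D.DeltaTheta σ f₀ with hg₀
  set g₁ := ContH1.conjCocycle D.toTheta D.DeltaTheta ((x : D.PiTemp) * σ) f₀ with hg₁
  set g₂ := ContH1.conjCocycle D.toTheta D.DeltaTheta ((x : D.PiTemp) * x * σ) f₀ with hg₂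
  -- `f = g₀|_{Ÿ̲̲} · ∂c₁`
  have hclass' : (QuotientGroup.mk (ContH1.resCocycle D.toTheta D.DeltaTheta
      (inf_le_left : C.GtpYdduu ≤ D.GtpYdd) g₀) : D.H1 C.GtpYdduu) = QuotientGroup.mk f := by
    change ContH1.res D.toTheta D.DeltaTheta inf_le_left
      (ContH1.conj D.toTheta D.DeltaTheta σ (QuotientGroup.mk f₀)) = _
    rw [hf₀]
    exact hclass.symm
  obtain ⟨c₁, hc₁⟩ := ContH1.exists_coboundary_of_mk_eq _ f hclass'
  -- `g₁ = x·g₀`, `g₂ = x·g₁`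
  have hg₁₀ : g₁ = ContH1.conjCocycle D.toTheta D.DeltaTheta (x : D.PiTemp) g₀ := by
    rw [hg₁, ContH1.conjCocycle_mul]
  have hg₂₁ : g₂ = ContH1.conjCocycle D.toTheta D.DeltaTheta (x : D.PiTemp) g₁ := by
    rw [hg₂, hg₁, mul_assoc, ContH1.conjCocycle_mul]
  -- pointwise: `(x·g)(k) = g(x⁻¹ k x)` for geometric `x`
  have hconj : ∀ (g : contCocycles D.toTheta D.DeltaTheta D.GtpYdd) (k : C.GtpYdduu),
      (ContH1.conjCocycle D.toTheta D.DeltaTheta (x : D.PiTemp) g).1 ⟨k, k.2.1⟩ =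
        g.1 ⟨(x : D.PiTemp)⁻¹ * k * x, C.inv_mul_mul_mem_GtpYdd hC x k⟩ := by
    intro g k
    rw [ContH1.conjCocycle_apply_eq (x : D.PiTemp) g ⟨k, k.2.1⟩
      ⟨(x : D.PiTemp)⁻¹ * k * x, C.inv_mul_mul_mem_GtpYdd hC x k⟩ rfl]
    exact conjNormal_eq_of_aug_eq_one hx _
  -- the three values of `f` along the orbit, for `k ∈ Π^tp_Ÿ̲̲`
  have hxk : ∀ k : C.GtpYdduu, (x : D.PiTemp)⁻¹ * k * x ∈ C.GtpYdduu :=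
    fun k => C.inv_mul_mul_mem_GtpYdduu hC x k
  have hf0 : ∀ k : C.GtpYdduu, f.1 k = g₀.1 ⟨k, k.2.1⟩ *
      (MulAut.conjNormal (D.toTheta (k : D.PiTemp)) c₁ * c₁⁻¹) := fun k => hc₁ k
  have hf1 : ∀ k : C.GtpYdduu, f.1 ⟨_, hxk k⟩ = g₁.1 ⟨k, k.2.1⟩ *
      (MulAut.conjNormal (D.toTheta (k : D.PiTemp)) c₁ * c₁⁻¹) := by
    intro k
    rw [hf0 ⟨_, hxk k⟩, hg₁₀, hconj]
    congr 2
    exact conjNormal_toTheta_conj_of_aug_eq_one hx _ _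
  have hf2 : ∀ k : C.GtpYdduu, f.1 ⟨_, hxk ⟨_, hxk k⟩⟩ = g₂.1 ⟨k, k.2.1⟩ *
      (MulAut.conjNormal (D.toTheta (k : D.PiTemp)) c₁ * c₁⁻¹) := by
    intro k
    rw [hf1 ⟨_, hxk k⟩, hg₂₁, hconj]
    congr 2
    exact conjNormal_toTheta_conj_of_aug_eq_one hx _ _
  -- ### the second difference class: `g₂ g₀ g₁⁻² = ρ^{2l} ∂b`
  obtain ⟨V, hV, hSD⟩ := E.secondDiff_conj_etaDd_eq hC h15 h15ii hx σ
  obtain ⟨v, hv⟩ : ∃ v : contCocycles (MonoidHom.id D.GtpTheta) D.DeltaTheta (D.GtpYdd.map D.toTheta),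
      (QuotientGroup.mk v : D.H1Theta (D.GtpYdd.map D.toTheta)) = V := QuotientGroup.mk_surjective _
  set e : ℤ := C.zExp x with he
  have hZ : Multiplicative.toAdd (D.toZ (x : D.PiTemp)) = (l : ℤ) * e := C.toZ_eq x
  set infv : contCocycles D.toTheta D.DeltaTheta D.GtpYdd :=
    ContH1.inflCocycle D.DeltaTheta D.toTheta D.continuous_toTheta le_rfl v with hinfv
  set ρ : contCocycles D.toTheta D.DeltaTheta D.GtpYdd := infv ^ e with hρ
  have hSD' : (QuotientGroup.mk (ρ ^ (2 * l)) : D.H1 D.GtpYdd) = QuotientGroup.mk (g₂ * g₀ * (g₁ ^ 2)⁻¹) := by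
    have hR : ρ ^ (2 * l) = infv ^ (2 * Multiplicative.toAdd (D.toZ (x : D.PiTemp))) := by
      rw [hρ, ← zpow_natCast, ← zpow_mul, hZ]
      congr 1
      push_cast
      ring
    have hL : (QuotientGroup.mk (g₂ * g₀ * (g₁ ^ 2)⁻¹) : D.H1 D.GtpYdd) =
        ContH1.conj D.toTheta D.DeltaTheta ((x : D.PiTemp) * x * σ) E.etaDd *
          ContH1.conj D.toTheta D.DeltaTheta σ E.etaDd *
          (ContH1.conj D.toTheta D.DeltaTheta ((x : D.PiTemp) * σ) E.etaDd ^ 2)⁻¹ := by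
      rw [← hf₀]; rfl
    rw [hR, QuotientGroup.mk_zpow, hL, hSD, ← hv]
    rfl
  obtain ⟨b, hb⟩ := ContH1.exists_coboundary_of_mk_eq _ _ hSD'
  -- `v` is fixed by `x̄` up to a coboundary `∂b₂` (its class `V ∈ F̈²` is fixed)
  have hvfix : (QuotientGroup.mk v : D.H1Theta (D.GtpYdd.map D.toTheta)) =
      QuotientGroup.mk (ContH1.conjCocycle (MonoidHom.id D.GtpTheta) D.DeltaTheta (D.toTheta x) v) := by
    change _ = ContH1.conj (MonoidHom.id D.GtpTheta) D.DeltaTheta (D.toTheta x) (QuotientGroup.mk v)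
    rw [hv, conj_eq_self_of_mem_Fdd2 hC hx hV]
  obtain ⟨b₂, hb₂⟩ := ContH1.exists_coboundary_of_mk_eq _ _ hvfix
  -- ### pointwise consequences on `Π^tp_Ÿ̲̲`
  -- (E1) the `l·Δ_Θ`-valued second difference of `f`
  have hE1 : ∀ k : C.GtpYdduu, f.1 ⟨_, hxk ⟨_, hxk k⟩⟩ * f.1 k * (f.1 ⟨_, hxk k⟩ ^ 2)⁻¹ =
      ρ.1 ⟨k, k.2.1⟩ ^ (2 * l) * (MulAut.conjNormal (D.toTheta (k : D.PiTemp)) b * b⁻¹) := by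
    intro k
    have h3 := hb ⟨k, k.2.1⟩
    have hprod : (g₂ * g₀ * (g₁ ^ 2)⁻¹).1 ⟨k, k.2.1⟩ =
        g₂.1 ⟨k, k.2.1⟩ * g₀.1 ⟨k, k.2.1⟩ * (g₁.1 ⟨k, k.2.1⟩ ^ 2)⁻¹ := rfl
    have hpow : (ρ ^ (2 * l)).1 ⟨k, k.2.1⟩ = ρ.1 ⟨k, k.2.1⟩ ^ (2 * l) := rfl
    rw [hprod, hpow] at h3
    rw [hf2, hf0, hf1, ← h3]
    apply (Additive.ofMul : D.DeltaTheta ≃ _).injective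
    simp only [ofMul_mul, ofMul_inv, ofMul_pow]
    abel
  -- (E2) `ρ(x⁻¹ k x) = ρ(k) · ∂(b₂^e)(k)`
  have hE2 : ∀ k : C.GtpYdduu, ρ.1 ⟨_, C.inv_mul_mul_mem_GtpYdd hC x k⟩ =
      ρ.1 ⟨k, k.2.1⟩ * (MulAut.conjNormal (D.toTheta (k : D.PiTemp)) (b₂ ^ e) * (b₂ ^ e)⁻¹) := by
    intro k
    have hkbar : D.toTheta (k : D.PiTemp) ∈ D.GtpYdd.map D.toTheta := ⟨k, k.2.1, rfl⟩
    have h4 := hb₂ ⟨D.toTheta (k : D.PiTemp), hkbar⟩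
    rw [ContH1.conjCocycle_apply, MonoidHom.id_apply, conjNormal_eq_of_aug_eq_one hx,
      MonoidHom.id_apply] at h4
    have hpt : MulAut.conjNormal ((D.toTheta (x : D.PiTemp))⁻¹)
        (⟨D.toTheta (k : D.PiTemp), hkbar⟩ : D.GtpYdd.map D.toTheta) =
        ⟨D.toTheta ((x : D.PiTemp)⁻¹ * k * x), ⟨_, C.inv_mul_mul_mem_GtpYdd hC x k, rfl⟩⟩ := by
      apply Subtype.ext
      rw [MulAut.conjNormal_apply]
      show (D.toTheta (x : D.PiTemp))⁻¹ * D.toTheta (k : D.PiTemp) * (D.toTheta (x : D.PiTemp))⁻¹⁻¹ =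
        D.toTheta ((x : D.PiTemp)⁻¹ * k * x)
      rw [inv_inv, map_mul, map_mul, map_inv]
    rw [hpt] at h4
    have hρv : ∀ (k' : D.PiTemp) (hk' : k' ∈ D.GtpYdd), ρ.1 ⟨k', hk'⟩ =
        v.1 ⟨D.toTheta k', ⟨k', hk', rfl⟩⟩ ^ e := fun k' hk' => rfl
    rw [hρv, hρv, h4, mul_zpow, cob_zpow]
  -- membership of the stray coboundary value in `l·Δ_Θ`
  refine ⟨fun k => ρ.1 ⟨k, k.2.1⟩, b, b₂ ^ e, fun k => hE1 k, fun k => hE2 k⟩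

/-- **The bi-theta shift clause of Prop 2.14 (iii) for the §1 model** (cocycle form used by Cor 2.16):
for a GEOMETRIC `x ∈ Π^tp_X̲̲` (`aug x = 1`), a root cocycle `f` of `η̲̈^{Θ,l·ℤ×μ₂}` and `a ∈ ℤ` with `M ∣ a`,
conjugation by `x^a` carries the mod-`M` theta cocycle `red ∘ f` to itself times a `μ_M`-coboundary — from
Prop 1.5 (ii), (iii) (t1's named facts) via the second difference of the orbit and the parity trick.
[cite: MochizukiEtTh2009, Prop 2.14(iii) p.50] -/
theorem conjCocycle_zpow_modN_eq_mul_coboundary (hC : D.Compat) (hS : D.Sec2Hyps)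
    (h15 : Prop15iii E hC) (h15ii : Prop15ii E.toKummerData hC) (M : Es)
    {f : contCocycles D.toTheta D.DeltaTheta C.GtpYdduu} (hf : f ∈ C.rootCocycles hC)
    (x : C.Huu) (hx : D.aug.toMonoidHom (x : D.PiTemp) = 1) (a : ℤ) (ha : (((M : ℕ+) : ℕ) : ℤ) ∣ a) :
    ∃ c : MuN p M, (C.thetaEnvTower τ hC hS).conjCocycle M (x ^ a) (C.modN (τ.mod M) f hf.1) =
      C.modN (τ.mod M) f hf.1 *
        CycEnvelope.coboundary ((C.thetaEnvTower τ hC hS).aug.comp (C.thetaEnvTower τ hC hS).PiYdd.subtype)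
          ((C.thetaEnvTower τ hC hS).chi M) c := by
  set T := C.thetaEnvTower τ hC hS with hT
  set μ := τ.mod M with hμ
  haveI : T.PiYdd.Normal := T.PiYdd_normal
  have hxk : ∀ k : C.GtpYdduu, (x : D.PiTemp)⁻¹ * k * x ∈ C.GtpYdduu :=
    fun k => C.inv_mul_mul_mem_GtpYdduu hC x k
  obtain ⟨ρ₀, b, B, hE1, hE2⟩ := C.exists_secondDiff_pointwise hC h15 h15ii hf x hx
  have hQ : ∀ k : C.GtpYdduu,
      ((MulAut.conjNormal (D.toTheta (k : D.PiTemp)) b * b⁻¹ : D.DeltaTheta) : D.GtpTheta) ∈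
        D.lDeltaTheta l := by
    intro k
    have h := hE1 k
    rw [← inv_mul_eq_iff_eq_mul] at h
    rw [← h]
    simp only [Subgroup.coe_mul, Subgroup.coe_inv, Subgroup.coe_pow]
    refine mul_mem (inv_mem ?_) (mul_mem (mul_mem (hf.1 _) (hf.1 _)) (inv_mem (pow_mem (hf.1 _) _)))
    rw [← Subgroup.coe_pow]
    exact coe_pow_pow_mem_lDeltaTheta l 2 _
  have hP : ∀ k : C.GtpYdduu, ((ρ₀ k ^ (2 * l) : D.DeltaTheta) : D.GtpTheta) ∈ D.lDeltaTheta l :=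
    fun k => coe_pow_pow_mem_lDeltaTheta l 2 _
  have hPl : ∀ k : C.GtpYdduu, ((ρ₀ k ^ l : D.DeltaTheta) : D.GtpTheta) ∈ D.lDeltaTheta l :=
    fun k => coe_pow_mem_lDeltaTheta l _
  -- ### the `μ_M`-level data for the generic lemma
  set η : T.PiYdd → T.mu M := C.modN μ f hf.1 with hη
  set ψ : T.PiYdd → T.mu M := T.conjCocycle M x η * η⁻¹ with hψ
  set ν : T.PiYdd → T.mu M := T.conjCocycle M x ψ * ψ⁻¹ with hν
  -- `ν = red(ρ^{2l}) · red(∂b)` pointwise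
  have hνval : ∀ g : T.PiYdd, ν g = μ.red ⟨_, hP (C.inclYdduu g)⟩ * μ.red ⟨_, hQ (C.inclYdduu g)⟩ := by
    intro g
    have hA : ν g = μ.red ⟨_, hf.1 ⟨_, hxk ⟨_, hxk (C.inclYdduu g)⟩⟩⟩ *
        (μ.red ⟨_, hf.1 ⟨_, hxk (C.inclYdduu g)⟩⟩)⁻¹ *
        (μ.red ⟨_, hf.1 ⟨_, hxk (C.inclYdduu g)⟩⟩ * (μ.red ⟨_, hf.1 (C.inclYdduu g)⟩)⁻¹)⁻¹ := by
      rw [hν, Pi.mul_apply, Pi.inv_apply, C.conjCocycle_apply_of_aug_eq_one τ hC hS M ψ x hx, hψ,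
        Pi.mul_apply, Pi.inv_apply, Pi.mul_apply, Pi.inv_apply,
        C.conjCocycle_modN_apply τ hC hS M f hf.1 x hx, C.conjCocycle_modN_apply τ hC hS M f hf.1 x hx]
      rfl
    rw [hA, ← map_inv μ.red, ← map_inv μ.red, ← map_mul μ.red, ← map_mul μ.red, ← map_inv μ.red,
      ← map_mul μ.red, ← map_mul μ.red]
    congr 1
    apply Subtype.ext
    have hΔ : f.1 ⟨_, hxk ⟨_, hxk (C.inclYdduu g)⟩⟩ * (f.1 ⟨_, hxk (C.inclYdduu g)⟩)⁻¹ *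
        (f.1 ⟨_, hxk (C.inclYdduu g)⟩ * (f.1 (C.inclYdduu g))⁻¹)⁻¹ =
        ρ₀ (C.inclYdduu g) ^ (2 * l) *
          (MulAut.conjNormal (D.toTheta ((C.inclYdduu g : C.GtpYdduu) : D.PiTemp)) b * b⁻¹) := by
      rw [← hE1 (C.inclYdduu g)]
      apply (Additive.ofMul : D.DeltaTheta ≃ _).injective
      simp only [ofMul_mul, ofMul_inv, ofMul_pow]
      abel
    simpa only [Subgroup.coe_mul, Subgroup.coe_inv] using
      congrArg (fun z : D.DeltaTheta => (z : D.GtpTheta)) hΔ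
  -- h2: `ν = ν'^2 · ∂c₂`
  set ν' : T.PiYdd → T.mu M := fun g => μ.red ⟨_, hPl (C.inclYdduu g)⟩ *
    μ.red ⟨((((MulAut.conjNormal (D.toTheta ((C.inclYdduu g : C.GtpYdduu) : D.PiTemp)) b * b⁻¹) ^
      ((l + 1) / 2)) : D.DeltaTheta) : D.GtpTheta), by
        rw [Subgroup.coe_pow]; exact pow_mem (hQ (C.inclYdduu g)) _⟩ with hν'
  set c₂ : MuN p M := μ.red ⟨_, coe_pow_mem_lDeltaTheta l b⟩ with hc₂
  have h2 : ∃ c : T.mu M, ν = ν' ^ 2 * CycEnvelope.coboundary (T.aug.comp T.PiYdd.subtype) (T.chi M) c := by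
    refine ⟨c₂, funext fun g => ?_⟩
    rw [hνval, Pi.mul_apply, Pi.pow_apply]
    simp only [hν']
    rw [mul_pow, μ.red_cob_eq_sq_mul C.l_odd _ b (hQ (C.inclYdduu g))]
    have hPsq : μ.red ⟨_, hP (C.inclYdduu g)⟩ = μ.red ⟨_, hPl (C.inclYdduu g)⟩ ^ 2 := by
      rw [← map_pow]
      congr 1
      apply Subtype.ext
      show ((ρ₀ (C.inclYdduu g) ^ (2 * l) : D.DeltaTheta) : D.GtpTheta) =
        ((ρ₀ (C.inclYdduu g) ^ l : D.DeltaTheta) : D.GtpTheta) ^ 2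
      rw [Subgroup.coe_pow, Subgroup.coe_pow, pow_mul, pow_right_comm]
    rw [hPsq]
    have hcob : (galMuN p M (D.aug.toMonoidHom ((C.inclYdduu g : C.GtpYdduu) : D.PiTemp)) c₂ * c₂⁻¹)⁻¹ =
        CycEnvelope.coboundary (T.aug.comp T.PiYdd.subtype) (T.chi M) c₂ g := by
      rw [mul_inv_rev, inv_inv]
      rfl
    rw [hcob, mul_assoc]
  -- h3: `x·ν = ν · ∂c₃`
  set c₃ : MuN p M := μ.red ⟨_, coe_pow_pow_mem_lDeltaTheta l 2 B⟩ with hc₃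
  have h3 : ∃ c : T.mu M, T.conjCocycle M x ν =
      ν * CycEnvelope.coboundary (T.aug.comp T.PiYdd.subtype) (T.chi M) c := by
    refine ⟨c₃⁻¹, funext fun g => ?_⟩
    rw [C.conjCocycle_apply_of_aug_eq_one τ hC hS M ν x hx, hνval, Pi.mul_apply, hνval]
    -- the point `x⁻¹ g x` of `Π^tp_Ÿ̲̲` and its two membership witnesses
    have hQx : μ.red ⟨_, hQ (C.inclYdduu ⟨x⁻¹ * (g : C.Huu) * x, by
        simpa [mul_assoc] using T.PiYdd_normal.conj_mem _ g.2 x⁻¹⟩)⟩ =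
        μ.red ⟨_, hQ (C.inclYdduu g)⟩ :=
      μ.red_eq_of_val_eq _ _ (by
        rw [C.coe_inclYdduu_conj, conjNormal_toTheta_conj_of_aug_eq_one hx])
    have hcobmem : ((MulAut.conjNormal (D.toTheta ((C.inclYdduu g : C.GtpYdduu) : D.PiTemp))
        (B ^ (2 * l)) * (B ^ (2 * l))⁻¹ : D.DeltaTheta) : D.GtpTheta) ∈ D.lDeltaTheta l := by
      rw [Subgroup.coe_mul, Subgroup.coe_inv, MulAut.conjNormal_apply]
      exact mul_mem ((D.lDeltaTheta_normal l).conj_mem _ (coe_pow_pow_mem_lDeltaTheta l 2 _) _)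
        (inv_mem (coe_pow_pow_mem_lDeltaTheta l 2 _))
    have hPx : μ.red ⟨_, hP (C.inclYdduu ⟨x⁻¹ * (g : C.Huu) * x, by
        simpa [mul_assoc] using T.PiYdd_normal.conj_mem _ g.2 x⁻¹⟩)⟩ =
        μ.red ⟨_, hP (C.inclYdduu g)⟩ * μ.red ⟨_, hcobmem⟩ := by
      rw [← map_mul μ.red]
      apply μ.red_eq_of_val_eq
      have h : ((ρ₀ ⟨_, C.inv_mul_mul_mem_GtpYdduu hC x (C.inclYdduu g)⟩ ^ (2 * l) : D.DeltaTheta) :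
          D.GtpTheta) = (((ρ₀ (C.inclYdduu g) *
            (MulAut.conjNormal (D.toTheta ((C.inclYdduu g : C.GtpYdduu) : D.PiTemp)) B * B⁻¹)) ^ (2 * l) :
              D.DeltaTheta) : D.GtpTheta) :=
        congrArg (fun z : D.DeltaTheta => ((z ^ (2 * l) : D.DeltaTheta) : D.GtpTheta)) (hE2 (C.inclYdduu g))
      rw [mul_pow, cob_pow, Subgroup.coe_mul] at h
      exact h
    rw [hQx, hPx, μ.red_cob _ (B ^ (2 * l)) (coe_pow_pow_mem_lDeltaTheta l 2 _) hcobmem, ← hc₃,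
      CycEnvelope.coboundary_inv, Pi.inv_apply]
    have hcob : galMuN p M (D.aug.toMonoidHom ((C.inclYdduu g : C.GtpYdduu) : D.PiTemp)) c₃ * c₃⁻¹ =
        (CycEnvelope.coboundary (T.aug.comp T.PiYdd.subtype) (T.chi M) c₃ g)⁻¹ := by
      rw [CycEnvelope.coboundary, mul_inv_rev, inv_inv]
      rfl
    rw [hcob, mul_right_comm]
  -- h1 is definitional
  have h1 : ∃ c : T.mu M, T.conjCocycle M x (T.conjCocycle M x η * η⁻¹) =
      T.conjCocycle M x η * η⁻¹ * ν * CycEnvelope.coboundary (T.aug.comp T.PiYdd.subtype) (T.chi M) c :=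
    ⟨1, by rw [CycEnvelope.coboundary_one, mul_one, hν, hψ]; exact (mul_inv_cancel_comm_assoc _ _).symm⟩
  exact T.conjCocycle_zpow_eq_mul_coboundary_of_secondDiff M x η ν ν' h1 h2 h3 a ha

/-- **[EtTh] Cor 2.16 (Profinite Non-discreteness of Bi-theta Environments) for the MODEL tower of
`X̲̲`, conditional ONLY on Prop 1.5 (ii), (iii)** (abc-iut-L2-t1's named facts `Prop15ii`, `Prop15iii` —
the printed dependency): the binder `hshift` of `cor216_of_model` / `cor216_of_model_generator` is
discharged by `conjCocycle_zpow_modN_eq_mul_coboundary` at a geometric generator of `Gal(Y̲̲/X̲̲)`.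
[cite: MochizukiEtTh2009, Cor 2.16 p.53] -/
theorem cor216_of_model_of_prop15 (hC : D.Compat) (hS : D.Sec2Hyps) (h15 : Prop15iii E hC)
    (h15ii : Prop15ii E.toKummerData hC) : (C.thetaEnvTower τ hC hS).Cor216 := by
  obtain ⟨x, hx1, haug, hx⟩ := C.exists_geometric_generator τ hC hS
  refine (C.thetaEnvTower τ hC hS).cor216_of_generator_aux x hx1 haug ?_
  intro M η hη a ha
  obtain ⟨f, hf, rfl⟩ := hη
  exact C.conjCocycle_zpow_modN_eq_mul_coboundary τ hC hS h15 h15ii M hf x hx a (by exact_mod_cast ha)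

end EtaleThetaData.DoubleUnderline

end ThetaSetting

end Literature.AnabelianGeometry.EtaleTheta

end
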